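import Summits.ValiantsHypothesis.ValiantsHypothesis.Theorems.KPlusLogSqLawTridiagonalRealStaticPotentialSteps
import Summits.ValiantsHypothesis.ValiantsHypothesis.Theorems.LacunarySymmetroidMatrixDescartesCensusTwistedRolleMult

/-!
# Route «KPlusLogSqLaw», crux `WeakLifting` (stmt-ValiantsHypothesis-19561) — REAL side of the tridiagonal sector:
# the DESCARTES ROW of the α register — a static symmetric tridiagonal `m × m` monomial matrix has at most `F_{m+1}` monomials in its
# determinant and at most `F_{m+1} − 1` positive determinant zeros COUNTED WITH MULTIPLICITY (all sizes; `F` = Fibonacci)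

HONEST FRAMING.  Helper (`--supports stmt-ValiantsHypothesis-19561 --as helper`), seat val-sym-lift-p1 (g13), cell `pub-symmetroid`,
2026-08-28.  The desk's α target of record (`staticTridiagonal_definite_posRoots_le (B := C·m + C₀)`, lead R2102/R2114) asks for a LINEAR
law and is NOT proved here.  This file records the TRIVIAL (exponential) upper row that the register's table was missing beyond the exact
small sizes (`B 3 = 2`, `B 4 ≤ 3`): the monomials of the determinant are indexed by the matchings of the path (`F_{m+1}` of them), so
Descartes' rule of signs bounds the positive zeros — with multiplicity, the currency of conjecture (P) — by `F_{m+1} − 1`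
(`B 5 ≤ 7`, `B 6 ≤ 12`, `B 7 ≤ 20`, …).  No positivity of the diagonal and no irreducibility is needed.  The located values (`5, 7, 8, 10, 11,
14, 15, 16/18` for `m = 5, …, 12`) and the conditional row `2m − 2` (`card_posRoots_le_of_potentialLawP`) are far below; nothing here is
claimed to be sharp.  Nothing here bears on `WeakLifting` / `TropicalB` (stmt-19771) in their windows, on Conjecture B, on the Door-A
registers, on `MatrixDescartes` (stmt-ValiantsHypothesis-18050) or on VP ≠ VNP.

WHAT IS PROVED (`D_k = pathDet a d b f k`, the continuant currency of `…TridiagonalRealStaticPotentialDefs`).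
* `card_support_pathDet_le_fib` — `#support(D_m) ≤ F_{m+1}` (three-term recurrence: a monomial multiple does not enlarge the support,
  a difference has support in the union; `F_{m+3} = F_{m+2} + F_{m+1}`).
* `countP_roots_pos_pathDet_le_fib` — positive roots of `D_m` WITH MULTIPLICITY `≤ F_{m+1} − 1` (Mathlib's Descartes rule
  `roots_countP_pos_le_signVariations` through lift-p3 g10's `countP_roots_pos_le_of_card_support_le`);
  `card_posRoots_pathDet_le_fib` — the same for distinct positive roots (tree: `Census.card_posRoots_le_countP_posRoots`).
* `countP_roots_pos_det_le_fib` / `card_posRoots_det_le_fib` — the row in the typed matrix currency of the α target (`c`, `e` symmetric,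
  `c = 0` off the band; via lift-p3 g10's `det_of_eq_pathDet`): **`#posRoots(det (c i j · X^(e i j))) ≤ F_{m+1} − 1`, with or without
  multiplicity, for every size `m`**; `card_posRoots_det_five_le_seven`, `card_posRoots_det_six_le_twelve` spell out `m = 5, 6`.
[folklore: continuants ↔ matchings of the path; Descartes' rule of signs]
-/

-- `Summit.ValiantsHypothesis.ValiantsHypothesis.…` repeats a component by the D-0017 layout (single-conjunct summit); the name is mandated.
set_option linter.dupNamespace false
set_option autoImplicit false

namespace Summit.ValiantsHypothesis.ValiantsHypothesis.Theorems.KPlusLogSqLaw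

namespace StaticTridiagonalRealCut

open Polynomial Finset
open Summit.ValiantsHypothesis.ValiantsHypothesis.Theorems.KPlusLogSqLaw.StaticTridiagonalRealPotential
  (pathDet pathDet_zero pathDet_one pathDet_add_two countP_roots_pos_le_of_card_support_le det_of_eq_pathDet)
open Summit.ValiantsHypothesis.ValiantsHypothesis.Theorems.LacunarySymmetroidMatrixDescartes.Census (card_posRoots_le_countP_posRoots)

variable (a : ℕ → ℝ) (d : ℕ → ℕ) (b : ℕ → ℝ) (f : ℕ → ℕ)

/-! ### The support of the continuant has at most `F_{m+1}` monomials -/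

/-- **`#support(D_m) ≤ F_{m+1}`**: the monomials of the `m`-th continuant are indexed by (a subset of) the matchings of the path on `m`
vertices, of which there are `F_{m+1}`. [folklore] -/
theorem card_support_pathDet_le_fib : ∀ m : ℕ, (pathDet a d b f m).support.card ≤ Nat.fib (m + 1) := by
  intro m
  induction m using Nat.strong_induction_on with
  | _ m ih =>
    rcases m with _ | _ | m
    · rw [pathDet_zero]
      calc (1 : ℝ[X]).support.card ≤ 1 := Polynomial.card_support_le_one_iff_monomial.2 ⟨0, 1, by simp⟩
        _ = Nat.fib 1 := Nat.fib_one.symm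
    · rw [pathDet_one]
      exact Polynomial.card_support_C_mul_X_pow_le_one.trans (by rw [Nat.fib_two])
    · have h1 := ih (m + 1) (by omega)
      have h0 := ih m (by omega)
      rw [pathDet_add_two, sub_eq_add_neg]
      refine (Finset.card_le_card Polynomial.support_add).trans ((Finset.card_union_le _ _).trans ?_)
      rw [show m + 2 + 1 = (m + 1) + 2 by ring, Nat.fib_add_two, Polynomial.support_neg,
        show (C (b m) * X ^ f m) ^ 2 = C (b m ^ 2) * X ^ (2 * f m) by rw [mul_pow, ← map_pow, ← pow_mul, mul_comm (f m)]]
      have e1 : (C (a (m + 1)) * X ^ d (m + 1) * pathDet a d b f (m + 1)).support.card ≤ Nat.fib (m + 1 + 1) :=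
        (Polynomial.card_support_mul_le.trans (Nat.mul_le_mul Polynomial.card_support_C_mul_X_pow_le_one h1)).trans (by omega)
      have e0 : (C (b m ^ 2) * X ^ (2 * f m) * pathDet a d b f m).support.card ≤ Nat.fib (m + 1) :=
        (Polynomial.card_support_mul_le.trans (Nat.mul_le_mul Polynomial.card_support_C_mul_X_pow_le_one h0)).trans (by omega)
      omega

/-! ### Descartes: positive roots, with and without multiplicity -/

/-- **Positive roots with multiplicity: `≤ F_{m+1} − 1`** (Descartes' rule of signs on at most `F_{m+1}` monomials). [folklore: Descartes] -/
theorem countP_roots_pos_pathDet_le_fib (m : ℕ) :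
    (pathDet a d b f m).roots.countP (fun x => 0 < x) ≤ Nat.fib (m + 1) - 1 := by
  refine countP_roots_pos_le_of_card_support_le ?_
  have hpos : 0 < Nat.fib (m + 1) := Nat.fib_pos.2 (Nat.succ_pos m)
  rw [Nat.sub_add_cancel hpos]
  exact card_support_pathDet_le_fib a d b f m

/-- **Distinct positive roots: `≤ F_{m+1} − 1`**. [folklore: Descartes] -/
theorem card_posRoots_pathDet_le_fib (m : ℕ) :
    ((pathDet a d b f m).roots.toFinset.filter (fun x => 0 < x)).card ≤ Nat.fib (m + 1) - 1 :=
  (card_posRoots_le_countP_posRoots _).trans (countP_roots_pos_pathDet_le_fib a d b f m)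

/-! ### The row in the matrix currency of the α target -/

/-- **DESCARTES ROW, with multiplicity**: a static symmetric tridiagonal `m × m` monomial matrix `(c i j · X^(e i j))` (`c`, `e` symmetric,
`c = 0` off the band) has at most `F_{m+1} − 1` positive determinant zeros counted with multiplicity. [folklore: Descartes] -/
theorem countP_roots_pos_det_le_fib (m : ℕ) (c : Fin m → Fin m → ℝ) (e : Fin m → Fin m → ℕ)
    (hc : ∀ i j, c i j = c j i) (he : ∀ i j, e i j = e j i)
    (hband : ∀ i j : Fin m, (i : ℕ) + 1 < j ∨ (j : ℕ) + 1 < i → c i j = 0) :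
    (Matrix.det (Matrix.of fun i j => C (c i j) * (X : ℝ[X]) ^ e i j)).roots.countP (fun x => 0 < x) ≤ Nat.fib (m + 1) - 1 := by
  rw [det_of_eq_pathDet c e hc he hband]
  exact countP_roots_pos_pathDet_le_fib _ _ _ _ m

/-- **DESCARTES ROW of the α register (all sizes)**: a static symmetric tridiagonal `m × m` monomial matrix has at most `F_{m+1} − 1`
distinct positive determinant zeros (`F_{m+1}` = number of matchings of the path = maximal number of monomials of the determinant).
Exponential and far from the located values; recorded as the register's trivial upper row. [folklore: Descartes] -/
theorem card_posRoots_det_le_fib (m : ℕ) (c : Fin m → Fin m → ℝ) (e : Fin m → Fin m → ℕ)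
    (hc : ∀ i j, c i j = c j i) (he : ∀ i j, e i j = e j i)
    (hband : ∀ i j : Fin m, (i : ℕ) + 1 < j ∨ (j : ℕ) + 1 < i → c i j = 0) :
    ((Matrix.det (Matrix.of fun i j => C (c i j) * (X : ℝ[X]) ^ e i j)).roots.toFinset.filter
      (fun t : ℝ => 0 < t)).card ≤ Nat.fib (m + 1) - 1 := by
  rw [det_of_eq_pathDet c e hc he hband]
  exact card_posRoots_pathDet_le_fib _ _ _ _ m

/-- `m = 5`: at most `F₆ − 1 = 7` distinct positive determinant zeros (located value `5`; exact value open). [corollary] -/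
theorem card_posRoots_det_five_le_seven (c : Fin 5 → Fin 5 → ℝ) (e : Fin 5 → Fin 5 → ℕ)
    (hc : ∀ i j, c i j = c j i) (he : ∀ i j, e i j = e j i)
    (hband : ∀ i j : Fin 5, (i : ℕ) + 1 < j ∨ (j : ℕ) + 1 < i → c i j = 0) :
    ((Matrix.det (Matrix.of fun i j => C (c i j) * (X : ℝ[X]) ^ e i j)).roots.toFinset.filter
      (fun t : ℝ => 0 < t)).card ≤ 7 :=
  (card_posRoots_det_le_fib 5 c e hc he hband).trans (by decide)

/-- `m = 6`: at most `F₇ − 1 = 12` distinct positive determinant zeros (located value `7`; exact value open). [corollary] -/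
theorem card_posRoots_det_six_le_twelve (c : Fin 6 → Fin 6 → ℝ) (e : Fin 6 → Fin 6 → ℕ)
    (hc : ∀ i j, c i j = c j i) (he : ∀ i j, e i j = e j i)
    (hband : ∀ i j : Fin 6, (i : ℕ) + 1 < j ∨ (j : ℕ) + 1 < i → c i j = 0) :
    ((Matrix.det (Matrix.of fun i j => C (c i j) * (X : ℝ[X]) ^ e i j)).roots.toFinset.filter
      (fun t : ℝ => 0 < t)).card ≤ 12 :=
  (card_posRoots_det_le_fib 6 c e hc he hband).trans (by decide)

end StaticTridiagonalRealCut

end Summit.ValiantsHypothesis.ValiantsHypothesis.Theorems.KPlusLogSqLaw
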